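import Summits.AtomisticToContinuum.Crystallization.Theses.ChessboardParticlePlanes
import Literature.MathematicalPhysics.StatisticalMechanics.PeriodicConfigurationSums
import Summits.AtomisticToContinuum.Crystallization.Theorems.ChessboardParticlePlanesLjBilayerHcpStubPresentation
import Summits.AtomisticToContinuum.Crystallization.Theorems.ChessboardParticlePlanesLjBilayerHcpStubNormalForm
import Summits.AtomisticToContinuum.Crystallization.Theorems.ChessboardParticlePlanesLjBilayerHcpStubEnergyIdentity

/-!
# Crux `ChessboardParticlePlanes.LjBilayerHcp` (stmt-AtomisticToContinuum-6710), line `Sketch`, transfer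
# `ljBilayerHcp_of_oneLayer` — the crux follows from the half-phantom one-layer inequality (the line's transfer)

This file makes the TRANSFER of the line importable: the crux
`Summit.AtomisticToContinuum.Crystallization.Theses.ChessboardParticlePlanes.LjBilayerHcp` (relaxed hcp minimises the
Lennard-Jones energy per particle among `2/3`-separated period-2 stacks with spacing `c ≥ 3/4`) follows from the
ONE-LAYER INEQUALITY `C⁺` of card `half-phantom-epitaxy` (the registered stub `stub_oneLayer`, quoted verbatim as the
hypothesis of `ljBilayerHcp_of_oneLayer`): for some `(a, h)` in the box and some split `β`, for every spacing `c ≥ 3/4`, every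
full-rank lattice `L ∋ 2c e₃` with heights in `2cℤ`, every layer motif `F₀` (heights `s + 2cℤ`) and phantom overlayer motif
`T₀` (heights `s + (2ℤ+1)c`), `L`-inequivalent with `2/3`-separated species sets,
`0 ≤ ½ Far(σ) + ¼ Near(σ) + (β − e(hcp a h)) #F₀ + ½ (Cross(σ, τ) + ½ Near(τ) − 2β #T₀)`.

PROOF (regrouping; Blanc–Lewin 2015 §2.1 (23) for the energy per particle).  By `stub_normalForm` (p104663) and
`stub_presentation` (p102865) it suffices to treat NORMAL presentations (`2c e₃ ∈ L`, heights of periods in `2cℤ`, heights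
of points in `cℤ`).  Split the motif by parity of the height, `F = F₀ ⊔ F₁`; `stub_energyIdentity` (p106374) rewrites
`2 #F · e(B) = ∑_{x ∈ F} ε_x` as `[Near₀ + Far₀ + Cross₀₁] + [Near₁ + Far₁ + Cross₁₀]`.  Apply `C⁺` to `(σ, τ) = (F₀, F₁)` with
base height `s = 0` and to `(F₁, F₀)` with `s = c`, and add: the `β`-terms cancel and the sum is `#F · (e(B) − e(hcp a h)) ≥ 0`.
-/

noncomputable section

open scoped BigOperators Classical
open Literature.MathematicalPhysics.StatisticalMechanics

namespace Summit.AtomisticToContinuum.Crystallization.Theorems.LjBilayerHcpSketch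

/-- **The core in normal form.** The rod-picture identity `h3` and the one-layer inequality `h4` (for fixed
`a, h, β`) give `e(hcp a h) ≤ e(B)` for every `2/3`-separated NORMAL presentation `B` (`2c e₃ ∈ L`, heights of
periods in `2cℤ`, heights of points in `cℤ`): split the motif by parity of the height, apply `h4` to `(F₀, F₁)`
with base height `0` and to `(F₁, F₀)` with base height `c`, add (the `β`-terms cancel), compare with `h3`.
[folklore; card half-phantom-epitaxy, identity `Regrouping`] -/
theorem reduction_core_of
    (h3 : ∀ (c : ℝ) (B : PeriodicConfiguration 3) (F₀ F₁ : Finset (EuclideanSpace ℝ (Fin 3))), c ≠ 0 →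
      (∀ g ∈ B.lattice, ∃ k : ℤ, g 2 = 2 * c * (k : ℝ)) →
      B.motif = F₀ ∪ F₁ →
      (∀ x ∈ F₀, ∃ k : ℤ, x 2 = 2 * c * (k : ℝ)) →
      (∀ x ∈ F₁, ∃ k : ℤ, x 2 = (2 * (k : ℝ) + 1) * c) →
      ∑ x ∈ B.motif, ∑' y : {y : (EuclideanSpace ℝ (Fin 3)) // y ∈ B.points ∧ y ≠ x}, lennardJones (dist x y.1) =
        (∑ x ∈ F₀,
          ((∑' y : {y : (EuclideanSpace ℝ (Fin 3)) // y ∈ {z : (EuclideanSpace ℝ (Fin 3)) | ∃ p ∈ F₀, ∃ g ∈ B.lattice, z = p + g} ∧ y ≠ x},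
              if dist x y.1 < 3 / 2 then lennardJones (dist x y.1) else 0) +
           (∑' y : {y : (EuclideanSpace ℝ (Fin 3)) // y ∈ {z : (EuclideanSpace ℝ (Fin 3)) | ∃ p ∈ F₀, ∃ g ∈ B.lattice, z = p + g} ∧ y ≠ x},
              if dist x y.1 < 3 / 2 then 0 else lennardJones (dist x y.1)) +
           (∑' y : {y : (EuclideanSpace ℝ (Fin 3)) // y ∈ {z : (EuclideanSpace ℝ (Fin 3)) | ∃ p ∈ F₁, ∃ g ∈ B.lattice, z = p + g}},
              lennardJones (dist x y.1)))) +
        (∑ x ∈ F₁,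
          ((∑' y : {y : (EuclideanSpace ℝ (Fin 3)) // y ∈ {z : (EuclideanSpace ℝ (Fin 3)) | ∃ p ∈ F₁, ∃ g ∈ B.lattice, z = p + g} ∧ y ≠ x},
              if dist x y.1 < 3 / 2 then lennardJones (dist x y.1) else 0) +
           (∑' y : {y : (EuclideanSpace ℝ (Fin 3)) // y ∈ {z : (EuclideanSpace ℝ (Fin 3)) | ∃ p ∈ F₁, ∃ g ∈ B.lattice, z = p + g} ∧ y ≠ x},
              if dist x y.1 < 3 / 2 then 0 else lennardJones (dist x y.1)) +
           (∑' y : {y : (EuclideanSpace ℝ (Fin 3)) // y ∈ {z : (EuclideanSpace ℝ (Fin 3)) | ∃ p ∈ F₀, ∃ g ∈ B.lattice, z = p + g}},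
              lennardJones (dist x y.1)))))
    {a h : ℝ} (ha : a ≠ 0) (hh : h ≠ 0) (β : ℝ)
    (h4 : ∀ c : ℝ, 3 / 4 ≤ c →
        ∀ (L : Submodule ℤ (EuclideanSpace ℝ (Fin 3))) [DiscreteTopology L], IsZLattice ℝ L →
          (2 * c) • EuclideanSpace.single (2 : Fin 3) (1 : ℝ) ∈ L →
          (∀ g ∈ L, ∃ k : ℤ, g 2 = 2 * c * (k : ℝ)) →
          ∀ (s : ℝ) (F₀ T₀ : Finset (EuclideanSpace ℝ (Fin 3))),
            (∀ x ∈ F₀, ∃ k : ℤ, x 2 = s + 2 * c * (k : ℝ)) →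
            (∀ y ∈ T₀, ∃ k : ℤ, y 2 = s + (2 * (k : ℝ) + 1) * c) →
            (∀ x ∈ F₀, ∀ y ∈ F₀, x - y ∈ L → x = y) →
            (∀ x ∈ T₀, ∀ y ∈ T₀, x - y ∈ L → x = y) →
            (∀ z ∈ {z : (EuclideanSpace ℝ (Fin 3)) | ∃ p ∈ F₀, ∃ g ∈ L, z = p + g}, ∀ w ∈ {z : (EuclideanSpace ℝ (Fin 3)) | ∃ p ∈ F₀, ∃ g ∈ L, z = p + g},
                z ≠ w → (2 : ℝ) / 3 ≤ dist z w) →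
            (∀ z ∈ {z : (EuclideanSpace ℝ (Fin 3)) | ∃ p ∈ T₀, ∃ g ∈ L, z = p + g}, ∀ w ∈ {z : (EuclideanSpace ℝ (Fin 3)) | ∃ p ∈ T₀, ∃ g ∈ L, z = p + g},
                z ≠ w → (2 : ℝ) / 3 ≤ dist z w) →
            0 ≤ (1 / 2) * (∑ x ∈ F₀,
                    ∑' y : {y : (EuclideanSpace ℝ (Fin 3)) // y ∈ {z : (EuclideanSpace ℝ (Fin 3)) | ∃ p ∈ F₀, ∃ g ∈ L, z = p + g} ∧ y ≠ x},
                      if dist x y.1 < 3 / 2 then 0 else lennardJones (dist x y.1)) +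
                (1 / 4) * (∑ x ∈ F₀,
                    ∑' y : {y : (EuclideanSpace ℝ (Fin 3)) // y ∈ {z : (EuclideanSpace ℝ (Fin 3)) | ∃ p ∈ F₀, ∃ g ∈ L, z = p + g} ∧ y ≠ x},
                      if dist x y.1 < 3 / 2 then lennardJones (dist x y.1) else 0) +
                (β - (hcpPeriodicConfiguration ha hh).energyPerParticle lennardJones) * (F₀.card : ℝ) +
                (1 / 2) * ((∑ x ∈ F₀,
                    ∑' y : {y : (EuclideanSpace ℝ (Fin 3)) // y ∈ {z : (EuclideanSpace ℝ (Fin 3)) | ∃ p ∈ T₀, ∃ g ∈ L, z = p + g}},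
                      lennardJones (dist x y.1)) +
                  (1 / 2) * (∑ y ∈ T₀,
                    ∑' w : {w : (EuclideanSpace ℝ (Fin 3)) // w ∈ {z : (EuclideanSpace ℝ (Fin 3)) | ∃ p ∈ T₀, ∃ g ∈ L, z = p + g} ∧ w ≠ y},
                      if dist y w.1 < 3 / 2 then lennardJones (dist y w.1) else 0) -
                  2 * β * (T₀.card : ℝ)))
    (c : ℝ) (hc : 3 / 4 ≤ c) (B : PeriodicConfiguration 3)
    (hsep : ∀ x ∈ B.points, ∀ y ∈ B.points, x ≠ y → (2 : ℝ) / 3 ≤ dist x y)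
    (h2c : (2 * c) • EuclideanSpace.single (2 : Fin 3) (1 : ℝ) ∈ B.lattice)
    (hL : ∀ g ∈ B.lattice, ∃ k : ℤ, g 2 = 2 * c * (k : ℝ))
    (hpts : ∀ x ∈ B.points, ∃ k : ℤ, x 2 = c * (k : ℝ)) :
    (hcpPeriodicConfiguration ha hh).energyPerParticle lennardJones ≤ B.energyPerParticle lennardJones := by
  classical
  have hc0 : c ≠ 0 := by linarith
  -- species split of the motif by parity of the height
  set F₀ : Finset (EuclideanSpace ℝ (Fin 3)) := B.motif.filter (fun x => ∃ k : ℤ, x 2 = 2 * c * (k : ℝ)) with hF₀def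
  set F₁ : Finset (EuclideanSpace ℝ (Fin 3)) := B.motif.filter (fun x => ∃ k : ℤ, x 2 = (2 * (k : ℝ) + 1) * c) with hF₁def
  have hF₀h : ∀ x ∈ F₀, ∃ k : ℤ, x 2 = 2 * c * (k : ℝ) := fun x hx => (Finset.mem_filter.1 hx).2
  have hF₁h : ∀ x ∈ F₁, ∃ k : ℤ, x 2 = (2 * (k : ℝ) + 1) * c := fun x hx => (Finset.mem_filter.1 hx).2
  have hF₀s : F₀ ⊆ B.motif := Finset.filter_subset _ _
  have hF₁s : F₁ ⊆ B.motif := Finset.filter_subset _ _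
  have hunion : B.motif = F₀ ∪ F₁ := by
    ext x
    simp only [Finset.mem_union, hF₀def, hF₁def, Finset.mem_filter]
    constructor
    · intro hx
      obtain ⟨k, hk⟩ := hpts x (B.mem_points_of_mem_motif hx)
      rcases Int.even_or_odd k with ⟨m, hm⟩ | ⟨m, hm⟩
      · exact Or.inl ⟨hx, m, by rw [hk, hm]; push_cast; ring⟩
      · exact Or.inr ⟨hx, m, by rw [hk, hm]; push_cast; ring⟩
    · rintro (⟨hx, _⟩ | ⟨hx, _⟩) <;> exact hx
  have hdisj : Disjoint F₀ F₁ := by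
    rw [Finset.disjoint_left]
    intro x hx0 hx1
    obtain ⟨k, hk⟩ := hF₀h x hx0
    obtain ⟨m, hm⟩ := hF₁h x hx1
    have h1 : (2 * (k : ℝ)) * c = (2 * (m : ℝ) + 1) * c := by rw [← hm, hk]; ring
    have h2 : (2 * (k : ℝ)) = 2 * (m : ℝ) + 1 := mul_right_cancel₀ hc0 h1
    have h3 : (2 * k : ℤ) = 2 * m + 1 := by exact_mod_cast h2
    omega
  have hcard : (B.motif.card : ℝ) = (F₀.card : ℝ) + (F₁.card : ℝ) := by
    rw [hunion, Finset.card_union_of_disjoint hdisj]; push_cast; ring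
  have hn : (0 : ℝ) < B.motif.card := by exact_mod_cast B.motif_nonempty.card_pos
  -- the rod-picture identity
  have hid := h3 c B F₀ F₁ hc0 hL hunion hF₀h hF₁h
  rw [Finset.sum_add_distrib, Finset.sum_add_distrib, Finset.sum_add_distrib,
    Finset.sum_add_distrib] at hid
  -- the two applications of the one-layer inequality
  haveI : DiscreteTopology B.lattice := B.discrete
  have hZ : IsZLattice ℝ B.lattice := B.isZLattice
  have hsub : ∀ (M : Finset (EuclideanSpace ℝ (Fin 3))), M ⊆ B.motif →
      {z : (EuclideanSpace ℝ (Fin 3)) | ∃ p ∈ M, ∃ g ∈ B.lattice, z = p + g} ⊆ B.points := by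
    intro M hM z hz
    obtain ⟨p, hp, g, hg, rfl⟩ := hz
    exact ⟨p, hM hp, g, hg, rfl⟩
  have hsepM : ∀ (M : Finset (EuclideanSpace ℝ (Fin 3))), M ⊆ B.motif →
      ∀ z ∈ {z : (EuclideanSpace ℝ (Fin 3)) | ∃ p ∈ M, ∃ g ∈ B.lattice, z = p + g},
        ∀ w ∈ {z : (EuclideanSpace ℝ (Fin 3)) | ∃ p ∈ M, ∃ g ∈ B.lattice, z = p + g}, z ≠ w → (2 : ℝ) / 3 ≤ dist z w :=
    fun M hM z hz w hw hzw => hsep z (hsub M hM hz) w (hsub M hM hw) hzw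
  have hineqM : ∀ (M : Finset (EuclideanSpace ℝ (Fin 3))), M ⊆ B.motif → ∀ x ∈ M, ∀ y ∈ M, x - y ∈ B.lattice → x = y :=
    fun M hM x hx y hy hxy => B.eq_of_sub_mem x (hM hx) y (hM hy) hxy
  have hineq0 := h4 c hc B.lattice hZ h2c hL 0 F₀ F₁
    (fun x hx => by obtain ⟨k, hk⟩ := hF₀h x hx; exact ⟨k, by rw [hk]; ring⟩)
    (fun y hy => by obtain ⟨k, hk⟩ := hF₁h y hy; exact ⟨k, by rw [hk]; ring⟩)
    (hineqM F₀ hF₀s) (hineqM F₁ hF₁s) (hsepM F₀ hF₀s) (hsepM F₁ hF₁s)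
  have hineq1 := h4 c hc B.lattice hZ h2c hL c F₁ F₀
    (fun x hx => by obtain ⟨k, hk⟩ := hF₁h x hx; exact ⟨k, by rw [hk]; ring⟩)
    (fun y hy => by
      obtain ⟨k, hk⟩ := hF₀h y hy
      exact ⟨k - 1, by rw [hk]; push_cast; ring⟩)
    (hineqM F₁ hF₁s) (hineqM F₀ hF₀s) (hsepM F₁ hF₁s) (hsepM F₀ hF₀s)
  -- arithmetic: `e · n ≤ ½ · ∑_{x ∈ F} ε_x = n · e(B)`
  show _ ≤ (2 * (B.motif.card : ℝ))⁻¹ *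
    ∑ x ∈ B.motif, ∑' y : {y : (EuclideanSpace ℝ (Fin 3)) // y ∈ B.points ∧ y ≠ x}, lennardJones (dist x y.1)
  rw [le_inv_mul_iff₀ (mul_pos two_pos hn), hid, hcard]
  have h01 := add_nonneg hineq0 hineq1
  have hn' : (0 : ℝ) < (F₀.card : ℝ) + (F₁.card : ℝ) := hcard ▸ hn
  nlinarith [h01, hn']

/-- **Pure logic of the line**: presentation invariance → normal form → rod-picture identity → one-layer
inequality → the crux. [folklore] -/
theorem reduction_composition
    (h1 : ∀ {d : ℕ} (V : ℝ → ℝ) (B B' : PeriodicConfiguration d) (v : EuclideanSpace ℝ (Fin d)),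
      B.points = (fun x => x + v) '' B'.points →
      B.energyPerParticle V = B'.energyPerParticle V)
    (h2 : ∀ (B : PeriodicConfiguration 3) (t c : ℝ), c ≠ 0 →
      (∀ x ∈ B.points, ∃ k : ℤ, x 2 = t + c * (k : ℝ)) →
      (∀ x ∈ B.points, x + (2 * c) • EuclideanSpace.single (2 : Fin 3) (1 : ℝ) ∈ B.points ∧
        x - (2 * c) • EuclideanSpace.single (2 : Fin 3) (1 : ℝ) ∈ B.points) →
      ∃ B' : PeriodicConfiguration 3,
        (2 * c) • EuclideanSpace.single (2 : Fin 3) (1 : ℝ) ∈ B'.lattice ∧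
        (∀ g ∈ B'.lattice, ∃ k : ℤ, g 2 = 2 * c * (k : ℝ)) ∧
        B.points = (fun x => x + t • EuclideanSpace.single (2 : Fin 3) (1 : ℝ)) '' B'.points)
    (h3 : ∀ (c : ℝ) (B : PeriodicConfiguration 3) (F₀ F₁ : Finset (EuclideanSpace ℝ (Fin 3))), c ≠ 0 →
      (∀ g ∈ B.lattice, ∃ k : ℤ, g 2 = 2 * c * (k : ℝ)) →
      B.motif = F₀ ∪ F₁ →
      (∀ x ∈ F₀, ∃ k : ℤ, x 2 = 2 * c * (k : ℝ)) →
      (∀ x ∈ F₁, ∃ k : ℤ, x 2 = (2 * (k : ℝ) + 1) * c) →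
      ∑ x ∈ B.motif, ∑' y : {y : (EuclideanSpace ℝ (Fin 3)) // y ∈ B.points ∧ y ≠ x}, lennardJones (dist x y.1) =
        (∑ x ∈ F₀,
          ((∑' y : {y : (EuclideanSpace ℝ (Fin 3)) // y ∈ {z : (EuclideanSpace ℝ (Fin 3)) | ∃ p ∈ F₀, ∃ g ∈ B.lattice, z = p + g} ∧ y ≠ x},
              if dist x y.1 < 3 / 2 then lennardJones (dist x y.1) else 0) +
           (∑' y : {y : (EuclideanSpace ℝ (Fin 3)) // y ∈ {z : (EuclideanSpace ℝ (Fin 3)) | ∃ p ∈ F₀, ∃ g ∈ B.lattice, z = p + g} ∧ y ≠ x},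
              if dist x y.1 < 3 / 2 then 0 else lennardJones (dist x y.1)) +
           (∑' y : {y : (EuclideanSpace ℝ (Fin 3)) // y ∈ {z : (EuclideanSpace ℝ (Fin 3)) | ∃ p ∈ F₁, ∃ g ∈ B.lattice, z = p + g}},
              lennardJones (dist x y.1)))) +
        (∑ x ∈ F₁,
          ((∑' y : {y : (EuclideanSpace ℝ (Fin 3)) // y ∈ {z : (EuclideanSpace ℝ (Fin 3)) | ∃ p ∈ F₁, ∃ g ∈ B.lattice, z = p + g} ∧ y ≠ x},
              if dist x y.1 < 3 / 2 then lennardJones (dist x y.1) else 0) +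
           (∑' y : {y : (EuclideanSpace ℝ (Fin 3)) // y ∈ {z : (EuclideanSpace ℝ (Fin 3)) | ∃ p ∈ F₁, ∃ g ∈ B.lattice, z = p + g} ∧ y ≠ x},
              if dist x y.1 < 3 / 2 then 0 else lennardJones (dist x y.1)) +
           (∑' y : {y : (EuclideanSpace ℝ (Fin 3)) // y ∈ {z : (EuclideanSpace ℝ (Fin 3)) | ∃ p ∈ F₀, ∃ g ∈ B.lattice, z = p + g}},
              lennardJones (dist x y.1)))))
    (h4 : ∃ a h : ℝ, ∃ (ha : a ≠ 0) (hh : h ≠ 0), 47 / 50 ≤ a ∧ a ≤ 1 ∧ 39 / 50 * a ≤ h ∧ h ≤ 17 / 20 * a ∧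
      ∃ β : ℝ, ∀ c : ℝ, 3 / 4 ≤ c →
        ∀ (L : Submodule ℤ (EuclideanSpace ℝ (Fin 3))) [DiscreteTopology L], IsZLattice ℝ L →
          (2 * c) • EuclideanSpace.single (2 : Fin 3) (1 : ℝ) ∈ L →
          (∀ g ∈ L, ∃ k : ℤ, g 2 = 2 * c * (k : ℝ)) →
          ∀ (s : ℝ) (F₀ T₀ : Finset (EuclideanSpace ℝ (Fin 3))),
            (∀ x ∈ F₀, ∃ k : ℤ, x 2 = s + 2 * c * (k : ℝ)) →
            (∀ y ∈ T₀, ∃ k : ℤ, y 2 = s + (2 * (k : ℝ) + 1) * c) →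
            (∀ x ∈ F₀, ∀ y ∈ F₀, x - y ∈ L → x = y) →
            (∀ x ∈ T₀, ∀ y ∈ T₀, x - y ∈ L → x = y) →
            (∀ z ∈ {z : (EuclideanSpace ℝ (Fin 3)) | ∃ p ∈ F₀, ∃ g ∈ L, z = p + g}, ∀ w ∈ {z : (EuclideanSpace ℝ (Fin 3)) | ∃ p ∈ F₀, ∃ g ∈ L, z = p + g},
                z ≠ w → (2 : ℝ) / 3 ≤ dist z w) →
            (∀ z ∈ {z : (EuclideanSpace ℝ (Fin 3)) | ∃ p ∈ T₀, ∃ g ∈ L, z = p + g}, ∀ w ∈ {z : (EuclideanSpace ℝ (Fin 3)) | ∃ p ∈ T₀, ∃ g ∈ L, z = p + g},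
                z ≠ w → (2 : ℝ) / 3 ≤ dist z w) →
            0 ≤ (1 / 2) * (∑ x ∈ F₀,
                    ∑' y : {y : (EuclideanSpace ℝ (Fin 3)) // y ∈ {z : (EuclideanSpace ℝ (Fin 3)) | ∃ p ∈ F₀, ∃ g ∈ L, z = p + g} ∧ y ≠ x},
                      if dist x y.1 < 3 / 2 then 0 else lennardJones (dist x y.1)) +
                (1 / 4) * (∑ x ∈ F₀,
                    ∑' y : {y : (EuclideanSpace ℝ (Fin 3)) // y ∈ {z : (EuclideanSpace ℝ (Fin 3)) | ∃ p ∈ F₀, ∃ g ∈ L, z = p + g} ∧ y ≠ x},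
                      if dist x y.1 < 3 / 2 then lennardJones (dist x y.1) else 0) +
                (β - (hcpPeriodicConfiguration ha hh).energyPerParticle lennardJones) * (F₀.card : ℝ) +
                (1 / 2) * ((∑ x ∈ F₀,
                    ∑' y : {y : (EuclideanSpace ℝ (Fin 3)) // y ∈ {z : (EuclideanSpace ℝ (Fin 3)) | ∃ p ∈ T₀, ∃ g ∈ L, z = p + g}},
                      lennardJones (dist x y.1)) +
                  (1 / 2) * (∑ y ∈ T₀,
                    ∑' w : {w : (EuclideanSpace ℝ (Fin 3)) // w ∈ {z : (EuclideanSpace ℝ (Fin 3)) | ∃ p ∈ T₀, ∃ g ∈ L, z = p + g} ∧ w ≠ y},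
                      if dist y w.1 < 3 / 2 then lennardJones (dist y w.1) else 0) -
                  2 * β * (T₀.card : ℝ))) :
    Summit.AtomisticToContinuum.Crystallization.Theses.ChessboardParticlePlanes.LjBilayerHcp := by
  obtain ⟨a, h, ha, hh, b1, b2, b3, b4, β, h4⟩ := h4
  refine ⟨a, h, ha, hh, b1, b2, b3, b4, fun B hsep hstack => ?_⟩
  obtain ⟨t, c, hc, hpl, hinv⟩ := hstack
  have hc0 : c ≠ 0 := by linarith
  obtain ⟨B', h2c, hL, hpts⟩ := h2 B t c hc0 hpl hinv
  have hmem : ∀ x ∈ B'.points, x + t • EuclideanSpace.single (2 : Fin 3) (1 : ℝ) ∈ B.points := by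
    intro x hx
    rw [hpts]
    exact ⟨x, hx, rfl⟩
  have hsep' : ∀ x ∈ B'.points, ∀ y ∈ B'.points, x ≠ y → (2 : ℝ) / 3 ≤ dist x y := by
    intro x hx y hy hxy
    have key := hsep _ (hmem x hx) _ (hmem y hy) (fun hxy' => hxy (add_right_cancel hxy'))
    rwa [dist_add_right] at key
  have hpts' : ∀ x ∈ B'.points, ∃ k : ℤ, x 2 = c * (k : ℝ) := by
    intro x hx
    obtain ⟨k, hk⟩ := hpl _ (hmem x hx)
    have h2 : (x + t • EuclideanSpace.single (2 : Fin 3) (1 : ℝ)) 2 = x 2 + t := by simp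
    exact ⟨k, by linarith⟩
  have key := reduction_core_of h3 ha hh β h4 c hc B' hsep' h2c hL hpts'
  rwa [h1 lennardJones B B' (t • EuclideanSpace.single (2 : Fin 3) (1 : ℝ)) hpts]

/-- **The reduction** (transfer of line `Sketch`): the half-phantom one-layer inequality `C⁺` (registered stub
`stub_oneLayer`, verbatim) implies the crux `LjBilayerHcp`, by `reduction_composition` fed with the landed stubs
`stub_presentation` (p102865), `stub_normalForm` (p104663), `stub_energyIdentity` (p106374).
[folklore; card half-phantom-epitaxy] -/
theorem ljBilayerHcp_of_oneLayer :
    (∃ a h : ℝ, ∃ (ha : a ≠ 0) (hh : h ≠ 0), 47 / 50 ≤ a ∧ a ≤ 1 ∧ 39 / 50 * a ≤ h ∧ h ≤ 17 / 20 * a ∧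
      ∃ β : ℝ, ∀ c : ℝ, 3 / 4 ≤ c →
        ∀ (L : Submodule ℤ (EuclideanSpace ℝ (Fin 3))) [DiscreteTopology L], IsZLattice ℝ L →
          (2 * c) • EuclideanSpace.single (2 : Fin 3) (1 : ℝ) ∈ L →
          (∀ g ∈ L, ∃ k : ℤ, g 2 = 2 * c * (k : ℝ)) →
          ∀ (s : ℝ) (F₀ T₀ : Finset (EuclideanSpace ℝ (Fin 3))),
            (∀ x ∈ F₀, ∃ k : ℤ, x 2 = s + 2 * c * (k : ℝ)) →
            (∀ y ∈ T₀, ∃ k : ℤ, y 2 = s + (2 * (k : ℝ) + 1) * c) →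
            (∀ x ∈ F₀, ∀ y ∈ F₀, x - y ∈ L → x = y) →
            (∀ x ∈ T₀, ∀ y ∈ T₀, x - y ∈ L → x = y) →
            (∀ z ∈ {z : (EuclideanSpace ℝ (Fin 3)) | ∃ p ∈ F₀, ∃ g ∈ L, z = p + g}, ∀ w ∈ {z : (EuclideanSpace ℝ (Fin 3)) | ∃ p ∈ F₀, ∃ g ∈ L, z = p + g},
                z ≠ w → (2 : ℝ) / 3 ≤ dist z w) →
            (∀ z ∈ {z : (EuclideanSpace ℝ (Fin 3)) | ∃ p ∈ T₀, ∃ g ∈ L, z = p + g}, ∀ w ∈ {z : (EuclideanSpace ℝ (Fin 3)) | ∃ p ∈ T₀, ∃ g ∈ L, z = p + g},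
                z ≠ w → (2 : ℝ) / 3 ≤ dist z w) →
            0 ≤ (1 / 2) * (∑ x ∈ F₀,
                    ∑' y : {y : (EuclideanSpace ℝ (Fin 3)) // y ∈ {z : (EuclideanSpace ℝ (Fin 3)) | ∃ p ∈ F₀, ∃ g ∈ L, z = p + g} ∧ y ≠ x},
                      if dist x y.1 < 3 / 2 then 0 else lennardJones (dist x y.1)) +
                (1 / 4) * (∑ x ∈ F₀,
                    ∑' y : {y : (EuclideanSpace ℝ (Fin 3)) // y ∈ {z : (EuclideanSpace ℝ (Fin 3)) | ∃ p ∈ F₀, ∃ g ∈ L, z = p + g} ∧ y ≠ x},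
                      if dist x y.1 < 3 / 2 then lennardJones (dist x y.1) else 0) +
                (β - (hcpPeriodicConfiguration ha hh).energyPerParticle lennardJones) * (F₀.card : ℝ) +
                (1 / 2) * ((∑ x ∈ F₀,
                    ∑' y : {y : (EuclideanSpace ℝ (Fin 3)) // y ∈ {z : (EuclideanSpace ℝ (Fin 3)) | ∃ p ∈ T₀, ∃ g ∈ L, z = p + g}},
                      lennardJones (dist x y.1)) +
                  (1 / 2) * (∑ y ∈ T₀,
                    ∑' w : {w : (EuclideanSpace ℝ (Fin 3)) // w ∈ {z : (EuclideanSpace ℝ (Fin 3)) | ∃ p ∈ T₀, ∃ g ∈ L, z = p + g} ∧ w ≠ y},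
                      if dist y w.1 < 3 / 2 then lennardJones (dist y w.1) else 0) -
                  2 * β * (T₀.card : ℝ))) →
    Summit.AtomisticToContinuum.Crystallization.Theses.ChessboardParticlePlanes.LjBilayerHcp :=
  fun h4 => reduction_composition (fun V B B' v h => stub_presentation V B B' v h) stub_normalForm
    stub_energyIdentity h4

end Summit.AtomisticToContinuum.Crystallization.Theorems.LjBilayerHcpSketch

end
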